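import Summits.QuantumFields.BalabanUV.Beta.D1BFx.CoarseLeg
import Summits.QuantumFields.BalabanUV.Beta.GAN24.MultiplierDictionary

/-!
# `BalabanUV.Beta.D1BFx.CoarseLegJunction` — road «BF-x» of binder row D1: the KERNEL-LEVEL JUNCTION between the road's coarse leg
# `CoarseLeg.CunZ n` / `Cun n a` (typer object T3, leaf-04, p208248) and an2's multiplier-response kernel `KernelSpecInstance.wΦ` of the packed
# one-step resolvent of blocking `n`: **`wΦ^{(n)} κ l z = 2·n^{−8}·CunZ n z 0 κ l`** for EVERY block size `n ≥ 1` — the `(inr,inr)` third of the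
# K-R2 dictionary made a theorem BY NAME from the landed `GAN24/MultiplierDictionary.wΦ_eq_deltaZ`

HONEST DEPENDENCY (verbatim): continuum YM on T⁴ ⇐ BetaPertH ∧ nine spine estimates (0/9 proved); BetaPertH ⇐ (D1) ∧ (D4) ∧ CAP+tail; G-an2-4
gates asym, D1 and NE2/3/4.  HONEST FRAMING (cell contract): discharging `BetaPertH` makes Bałaban's UV stability UNCONDITIONAL — NOT the
continuum limit and NOT the Clay problem.  THIS FILE is [folklore] bookkeeping for ONE road (BF-x) to ONE conjunct (D1); it instantiates 0 wall
binders, asserts nothing printed, mints no `Prop`; 0 sorry.  Staged by the D1 formalisation-swarm typer (planner-b2b-balaban-beta-d1-formalise-typer-0)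
for a prover-role courier (leaf-04's append offer l.6082 / road owner b2b-balaban-beta-d1-p2); «not in print; our bookkeeping».  NOT summit progress.

ABSOLUTE RULE (cell, verbatim): «No internally-minted statement may enter as a cited fact. Every hypothesis is either kernel-proved in this
package or a verbatim quotation of a PUBLISHED theorem with page reference. The manuscript(s) under audit are NOT citable for their own disputed
steps — they are the thing under adjudication; programme-internal (2001/route/tribunal) claims are never citable.»

## WHY (skeleton `HOME/beta/skeletons/D1-b2b-balaban-beta-d1-p2.md` v1.4 node K-R2; `LEAVES-BFx.md` row K-R2 «OWED: kernel level on ℤ⁴»)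

K-R2's block-inverse dictionary reads the three blocks of the packed resolvent `KInv n` against the reduced objects: `Gam = Ga − Ga Qᵀ Cun Q Ga`,
`wH = Ga Qᵀ Cun`, and the multiplier block «`wΦ = −Cun + a`» (model level: an2 `CompositionSingular.effForm_eq_of_reg`, `Envelope.kkt_inv`).
For an2's OWN multiplier kernel `KernelSpecInstance.wΦ` (Euler–Lagrange convention `curvAdj (curv A) = adjContourSum N φ + …`, `colA_EL`) the
multiplier third is ALREADY A THEOREM at kernel level on `ℤ⁴`, for every block size: gan24-leaf-13c's `MultiplierDictionary.wΦ_eq_deltaZ`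
(`wΦ^{(L^k)} = 2·(L^k)^{−(d+5)}·deltaZ L k`) at `L := n`, `k := 1`, read through leaf-04's `CoarseLeg.CunZ_pow_apply` (`CunZ (L^k) = deltaZ L k`
entrywise).  In an2's convention the relation carries the sign `+` and NO `a`-shift: `wΦ^{(n)} = 2n^{−8}·Δ^{(n)} = 2n^{−8}·(Cun n a − a·𝟙)`; which
sign/unit the ROAD's «`wΦ`» carries relative to an2's is the owner's units audit (`CHECK-N0.md`) — this file states only what is true of the
named tree objects.

## CONTENTS (0 sorry)
§1 index bookkeeping `wΦ_congr`, `CunZ_congr`, `CunZ_sub_zero` · §2 **`wΦ_eq_CunZ`** (the junction), `CunZ_eq_wΦ`, `Cun_eq_wΦ` (two-point forms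
via unit-lattice translation invariance) · §3 the entry bound of `wΦ^{(n)}` it transports: `|wΦ^{(n)} κ l z| ≤ 2n^{−8}·c166Z 3·e^{−kappaZ 3·|z|₁}`
(`CoarseLeg.abs_CunZ_le` BY NAME).  NOT the `ff`/`fm` thirds of K-R2, NOT `BetaPertH`, NOT continuum, NOT Clay.
-/

namespace Summit.QuantumFields.BalabanUV.Beta.D1BFx.CoarseLegJunction

open Literature.MathematicalPhysics.QuantumFieldTheory.Balaban1983to89
open Literature.MathematicalPhysics.QuantumFieldTheory.Balaban1983to89.Beta
open B12Sec2to5 (l1)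
open ExpKernelCalculus (Site MKer)
open KernelSpecInstance (wΦ)
open Summit.QuantumFields.BalabanUV.Beta.GAN24.DirichletExhaustionDeltaZ (deltaZ c166Z kappaZ)
open Summit.QuantumFields.BalabanUV.Beta.GAN24.MultiplierDictionary (wΦ_eq_deltaZ)
open Summit.QuantumFields.BalabanUV.Beta.D1BFx.CoarseLeg (CunZ Cun CunZ_apply Cun_apply CunZ_pow_apply abs_CunZ_le)

noncomputable section

variable (n : ℕ) [NeZero n] (a : ℝ)

/-! ## §1 Index bookkeeping -/

/-- [folklore] `wΦ` does not depend on the syntactic form of its blocking index. -/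
theorem wΦ_congr {N M : ℕ} [NeZero N] [NeZero M] (h : N = M) (κ l : Fin 4) (z : Site 4) :
    wΦ (d := 3) (N := N) κ l z = wΦ (d := 3) (N := M) κ l z := by
  subst h; rfl

/-- [folklore] Neither does `CunZ`. -/
theorem CunZ_congr {N M : ℕ} [NeZero N] [NeZero M] (h : N = M) : CunZ N = CunZ M := by
  subst h; rfl

/-- [folklore] `CunZ n` is a function of `y − y′`: `CunZ n y y′ β β′ = CunZ n (y − y′) 0 β β′`. -/
theorem CunZ_sub_zero (y y' : Site 4) (β β' : Fin 4) : CunZ n y y' β β' = CunZ n (y - y') 0 β β' := by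
  simp only [CunZ_apply, sub_zero]

/-! ## §2 The junction -/

/-- [folklore] **THE mm JUNCTION, every block size `n ≥ 1`**: an2's multiplier-response kernel of the packed resolvent of blocking `n` IS `2·n^{−8}`
times the road's unit-lattice action kernel: `wΦ^{(n)} κ l z = 2·(n^8)⁻¹ · CunZ n z 0 κ l` — `MultiplierDictionary.wΦ_eq_deltaZ n 1` and
`CoarseLeg.CunZ_pow_apply n 1` BY NAME, `n¹ = n`. -/
theorem wΦ_eq_CunZ (κ l : Fin 4) (z : Site 4) :
    wΦ (d := 3) (N := n) κ l z = 2 * ((n : ℝ) ^ 8)⁻¹ * CunZ n z 0 κ l := by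
  rw [wΦ_congr (pow_one n).symm κ l z, wΦ_eq_deltaZ n 1 κ l z, ← CunZ_pow_apply n 1 z 0 κ l, CunZ_congr (pow_one n)]
  norm_num

/-- [folklore] The junction solved for the road's kernel, two-point form: `CunZ n y y′ β β′ = (n^8/2)·wΦ^{(n)} β β′ (y − y′)`. -/
theorem CunZ_eq_wΦ (y y' : Site 4) (β β' : Fin 4) :
    CunZ n y y' β β' = ((n : ℝ) ^ 8 / 2) * wΦ (d := 3) (N := n) β β' (y - y') := by
  rw [CunZ_sub_zero n y y', wΦ_eq_CunZ n β β' (y - y'), ← mul_assoc]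
  have hn : (n : ℝ) ^ 8 ≠ 0 := pow_ne_zero _ (Nat.cast_ne_zero.2 (NeZero.ne n))
  have h1 : (n : ℝ) ^ 8 / 2 * (2 * ((n : ℝ) ^ 8)⁻¹) = 1 := by
    rw [div_mul_eq_mul_div, ← mul_assoc, mul_comm ((n : ℝ) ^ 8) 2, mul_assoc, mul_inv_cancel₀ hn, mul_one, div_self two_ne_zero]
  rw [h1, one_mul]

/-- [folklore] **K-R2's multiplier third for an2's `wΦ`, as a theorem**: `Cun n a y y′ β β′ = (n^8/2)·wΦ^{(n)} β β′ (y − y′) + a·[y = y′ ∧ β = β′]`. -/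
theorem Cun_eq_wΦ (y y' : Site 4) (β β' : Fin 4) :
    Cun n a y y' β β' = ((n : ℝ) ^ 8 / 2) * wΦ (d := 3) (N := n) β β' (y - y') + a * (if y = y' ∧ β = β' then 1 else 0) := by
  rw [Cun_apply, CunZ_eq_wΦ]

/-- [folklore] Conversely `wΦ^{(n)} κ l z = 2n^{−8}·(Cun n a z 0 κ l − a·[z = 0 ∧ κ = l])` — «`wΦ ∝ Cun − a`» in an2's sign convention. -/
theorem wΦ_eq_Cun_sub (κ l : Fin 4) (z : Site 4) :
    wΦ (d := 3) (N := n) κ l z = 2 * ((n : ℝ) ^ 8)⁻¹ * (Cun n a z 0 κ l - a * (if z = 0 ∧ κ = l then 1 else 0)) := by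
  rw [Cun_apply, add_sub_cancel_right, wΦ_eq_CunZ]

/-! ## §3 The entry bound of `wΦ^{(n)}` transported through the junction -/

/-- [folklore] `|wΦ^{(n)} κ l z| ≤ 2n^{−8}·c166Z 3·e^{−kappaZ 3·|z|₁}` for every `n ≥ 1` (`CoarseLeg.abs_CunZ_le` BY NAME): explicit constants for
an2's `decay_wΦ` (which is an `∃ δ C`). -/
theorem abs_wΦ_le (κ l : Fin 4) (z : Site 4) :
    |wΦ (d := 3) (N := n) κ l z| ≤ 2 * ((n : ℝ) ^ 8)⁻¹ * c166Z 3 * Real.exp (-(kappaZ 3) * l1 z) := by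
  rw [wΦ_eq_CunZ n κ l z, abs_mul, mul_assoc]
  have h2 : |2 * ((n : ℝ) ^ 8)⁻¹| = 2 * ((n : ℝ) ^ 8)⁻¹ := abs_of_nonneg (by positivity)
  rw [h2]
  refine mul_le_mul_of_nonneg_left ?_ (by positivity)
  simpa using abs_CunZ_le n z 0 κ l

end

end Summit.QuantumFields.BalabanUV.Beta.D1BFx.CoarseLegJunction
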